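import Summits.ResolutionOfSingularities.ResolutionOfSingularities.Theses.CyclicCovers
import Summits.ResolutionOfSingularities.ResolutionOfSingularities.Theses.Valuative
import Summits.ResolutionOfSingularities.ResolutionOfSingularities.Theorems.ValuativeTorsorToLurelOfTemkin

/-!
# `CyclicCovers.AbhyankarReduction` from `Valuative.TorsorToLurel`

Route `ResolutionOfSingularities/CyclicCovers`, crux `AbhyankarReduction`
(stmt-ResolutionOfSingularities-13707):

  `AbhyankarReduction := AsAscentRel → EluRegular → ∀ p, p.Prime → TORSOR_p → LUrel_p`.

Its conclusion is VERBATIM route Valuative's item `TorsorToLurel`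
(stmt-ResolutionOfSingularities-10968), so the crux is implied by that item with the two
Cossart–Piltant hypotheses (`AsAscentRel` = Artin–Schreier ascent, `EluRegular` = embedded local
uniformization in regular models) UNUSED (`abhyankarReduction_of_torsorToLurel`, an inter-route
edge 10968 ⇒ 13707). Through the landed reductions of `TorsorToLurel`
(`ValuativeTorsorToLurelOfTemkin.lean`) the crux therefore holds modulo Temkin's inseparable
local uniformization theorem (Temkin 2013 = arXiv:0804.1554v3, Thm. 1.3.2, corrected relative
rendering `Temkin2013Relative`), i.e. modulo the single remaining leaf
`Temkin2013RelativeCurveSmoothFibre` (Thm. 3.3.1 for `k`-smooth generic fibres) of its proof cone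
in the tree (`abhyankarReduction_of_temkin2013Relative`, `abhyankarReduction_of_smoothFibre`,
both CONDITIONAL on the named Literature fact). No tame descent (Kuhlmann 2000, Open Problem 11)
and no dimension hypothesis enter.
-/

noncomputable section

set_option linter.dupNamespace false -- mandated namespace of this single-conjunct summit

open Literature.AlgebraicGeometry.Resolution

namespace Summit.ResolutionOfSingularities.ResolutionOfSingularities.Theorems

open Summit.ResolutionOfSingularities.ResolutionOfSingularities.Theses

/-- **Inter-route edge.** Route Valuative's `TorsorToLurel` (local uniformization of
`α_p`-torsors over regular bases ⇒ relative local uniformization, every ground field of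
characteristic `p`) implies route CyclicCovers' `AbhyankarReduction`; the hypotheses
`AsAscentRel` and `EluRegular` of the latter are not used. [folklore] -/
theorem abhyankarReduction_of_torsorToLurel (h : Valuative.TorsorToLurel) :
    CyclicCovers.AbhyankarReduction :=
  fun _ _ => h

/-- **The crux modulo Temkin's theorem** (CONDITIONAL on the named Literature fact
`Temkin2013Relative` = Temkin 2013, arXiv:0804.1554v3, Thm. 1.3.2, relative form, corrected
rendering), through `torsorToLurel_of_temkin2013Relative`. [cite: Temkin2013, Thm. 1.3.2] -/
theorem abhyankarReduction_of_temkin2013Relative (hTem : Temkin2013Relative.{0}) :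
    CyclicCovers.AbhyankarReduction :=
  abhyankarReduction_of_torsorToLurel (torsorToLurel_of_temkin2013Relative hTem)

/-- The same, CONDITIONAL on the single remaining leaf of the tree's proof cone of Temkin's
theorem, `Temkin2013RelativeCurveSmoothFibre` (Temkin 2013, Thm. 3.3.1 for `k`-smooth generic
fibres), through `torsorToLurel_of_smoothFibre`. [cite: Temkin2013, Thm. 3.3.1] -/
theorem abhyankarReduction_of_smoothFibre (hsf : Temkin2013RelativeCurveSmoothFibre.{0}) :
    CyclicCovers.AbhyankarReduction :=
  abhyankarReduction_of_torsorToLurel (torsorToLurel_of_smoothFibre hsf)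

end Summit.ResolutionOfSingularities.ResolutionOfSingularities.Theorems

end
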